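import Mathlib
import Summits.ResolutionOfSingularities.ResolutionOfSingularities.Theorems.WildQuotientsJordanBlockFourfoldOfJordanFour
import Summits.ResolutionOfSingularities.ResolutionOfSingularities.Theorems.WildQuotientsWildQuotientResolutionToricExitJordanFourFinal

/-!
# stmt-ResolutionOfSingularities-17942 `WildQuotients.JordanBlockFourfold`: `𝔸⁴/V₄` has a resolution for every `p ≥ 5`

(route WildQuotients, item stmt-ResolutionOfSingularities-17942 — the COMPUTED INSTANCE / first rung
of `CyclicQuotientFourfolds`; programme V4U of `L/w45c/CHAIN.md` v7 §4 row stub-4 «17942 one-liner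
`jordanBlockFourfold` the minute V4U-F lands (p490809)». [OURS · L1 W4.5c] — NOT a statement of any
manuscript; replaces the role of no printed item. Prover res-L1-w45c-stub-4.)

`JordanFour.jordanBlockFourfold_of_jordanFour'` (stub-3, p490809) instantiated with the `J₄` final
`JordanFour.jordanFour_hasResolution` (lead-1, V4U-F: every `p ≥ 5`, every field of characteristic
`p`, every `n`; twisted root charts + `μ₃`/`μ₂` cone exits + three-piece toric exit transfer).
-/

-- single-problem summit: the doubled namespace component `ResolutionOfSingularities` is forced
set_option linter.dupNamespace false

noncomputable section

open AlgebraicGeometry MvPolynomial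
open Literature.AlgebraicGeometry.Resolution

namespace Summit.ResolutionOfSingularities.ResolutionOfSingularities.Theorems.WildQuotientResolution.JordanFour

/-- **`JordanBlockFourfold` (stmt-ResolutionOfSingularities-17942).** For every prime `p ≥ 5` and
every perfect field `k` of characteristic `p`, the quotient `𝔸⁴_k / ⟨σ⟩` by the `4 × 4` unipotent
Jordan block has a resolution of singularities. [OURS · L1 W4.5c] -/
theorem jordanBlockFourfold_proof :
    Summit.ResolutionOfSingularities.ResolutionOfSingularities.Theses.WildQuotients.JordanBlockFourfold :=
  jordanBlockFourfold_of_jordanFour' 5 le_rfl fun p hp hp5 k _ _ n σ a b c d hab hac had hbc hbd hcd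
      hb hc hd hσ =>
    jordanFour_hasResolution p hp hp5 k n σ a b c d hab hac had hbc hbd hcd hb hc hd hσ

end Summit.ResolutionOfSingularities.ResolutionOfSingularities.Theorems.WildQuotientResolution.JordanFour

end
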